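import Summits.QuantumFields.YangMills.Theorems.BalabanUVNodesN07SymAxialRadialDefectOfBoxPlaquettes
import HarnessLib

/-!
# N07 [B11] (= [15] = [Balaban1985Variational]) Sect. F ∕ [I] (0.11) — **THE NUMERIC SCHEDULE OF THE (σ2) SUPPLIER FROM ONE FINE LETTER `a₀`**: an explicit per-level letter
# schedule `a(n) := 240·(d+2)L·Lⁿ·(d−1)(L^{n+1}−1)·a₀` and constant `ω := 3840·Ω₀(a₀)` meeting ALL numeric binders of `…N07SymTauTowerStatementOfFinePlaquettes` ∕
# `…N07SymTauCellRowOfFinePlaquettes` (`hbud`, `hgd`, `haa`, `h100`, `hguard`, `hE` with `θ := L⁻¹`) under four smallness conditions on `a₀`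

Cell `pub-ymgap`, width seat `pub-ymgap-dag-n07-w3` g13 (junction side of the K0 road; (σ2) numerics).  `--kind proof --supports stmt-QuantumFields-20541 --as helper` (K0⁷; count-neutral;
THEOREMS ONLY, 0 `def`).  [I] = [Balaban1987RG1]; [15] = [Balaban1985Variational]; [6] = [Balaban1985RegularSpaces].  Elementary real arithmetic; the two thresholds `deltaSU (Fin N)`
(`ExpMeanLog`) and `(FederbushMean.federbushSU).δ` enter only as the right-hand sides of two displayed smallness conditions.

WHY.  The (σ2) supplier (INTENT-21∕22 of this seat) carries, per level `n < k`, the numeric side conditions of ✓p755647 (`hbud`, `hgd`, `haa`, `h100`, `hguard`) for a displayed letter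
schedule `a : ℕ → ℝ`, and the geometric schedule `hE : 8σ′(a m) ≤ (ω∕2)·θ^{k−(m+1)}`.  With ONE fine letter `a₀` (row (17): `a₀ = ε_{j−1}·η_{j−1}²`) all of them follow from four smallness
conditions on `a₀` for the explicit choice `a(n) := 240·E₂(n)` (twice ✓p755647's `haa` threshold) and `ω := 3840·Ω₀`, `Ω₀ := d(d+2)(d−1)²·L^{2k+2}·a₀`, `θ := L⁻¹`: every letter is a
monomial in `L` of degree `≤ 2k + 2` times `a₀` (crude bounds `L^{n+1} − 1 ≤ L^{n+1}`, `⌊(L−1)∕2⌋ ≤ L`, `L − 1 ≤ L`, `n + 1 ≤ k`), and the geometric schedule holds because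
`L^{2m+4}·L^{k−m−1} ≤ L^{2k+2}` for `m + 1 ≤ k`.  With `a₀ = O(ε·L^{−2k})` this is `ω = O(L⁴·ε)` — the junction's `Ψ ε j = 1024·(4(ω_τ + ω_u))² = O(ε²)`.  NO estimate of [I]∕[15]∕[6].

WHAT IS PROVED (sorry-free; any `Params` member with `2 ≤ d`, `2 ≤ L`; `N ≥ 1`).
§1 the crude monomial bounds (`cast_pow_sub_one_le`, `one_le_cast_pow_sub_one`, `cast_mul_half_le`, `e2_le`, `sigma_le`, `e1_le`, `geom_step_le`).
§2 ★★★ `schedule_of_fineLetter` — `∃ a ω`, `ω = 3840·Ω₀`, `0 ≤ ω`, `∀ n, 0 ≤ a n`, and the six binder families `hbud`∕`hgd`∕`haa`∕`h100`∕`hguard` (`n < k`) and `hE` (`m < k`, `θ := L⁻¹`)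
   VERBATIM in the shape of `…N07SymTauTowerStatementOfFinePlaquettes.tower_statement_geom_of_fineBoxPlaqs` (generic `P`; instantiate `P := F.P K`).
HONEST FRAMING: count-neutral helper; elementary arithmetic — nothing of [I]∕[15]∕[6] asserted or discharged; the fine letter `a₀` and its four smallness conditions remain DISPLAYED; the cell
lemma's own numerics (`ω_τ + ω_u ≤ 1∕512`, `4096·θ·(ω_τ + ω_u) ≤ 1`) involve the (σ1) constant and are NOT here; `HThm4RecSym152PhiE(G)` ∕ `HThm4Rec*` UNDISCHARGED; N05 ∕ N07 NOT discharged;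
K0⁷ ∕ K1⁹ NOT closed; counts unmoved (typed 28∕28 · discharged 8∕28); R4 closes the conditional finite-𝕋⁴ rung `BalabanLadder.UV` only; the YM mass gap (Clay) is NOT proved by any of this;
nothing continuum ∕ ℝ⁴ ∕ OS.  No `def`, no `instance`, no `notation`, no `sorry`.

References: [I] (0.11) p. 253, (0.4) p. 253; [15] (147)–(154) pp. 301–302; [6] (1.15) p. 78.
-/

set_option autoImplicit false

noncomputable section

namespace Summit.QuantumFields.YangMills.BalabanUVNodes.N07SymTauScheduleNumerics

open Literature.MathematicalPhysics.QuantumFieldTheory.Balaban1983to89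
open ExpMeanLog (deltaSU)

variable {P : Params}

/-! ## §1  Crude monomial bounds -/

/-- `((L^{m} − 1 : ℕ) : ℝ) ≤ L^{m}`. [folklore] -/
theorem cast_pow_sub_one_le (m : ℕ) : (((P.L ^ m - 1 : ℕ) : ℝ)) ≤ (P.L : ℝ) ^ m := by
  have h : ((P.L ^ m - 1 : ℕ) : ℝ) ≤ ((P.L ^ m : ℕ) : ℝ) := by exact_mod_cast Nat.sub_le _ _
  simpa using h

/-- `1 ≤ ((L^{n+1} − 1 : ℕ) : ℝ)` for `2 ≤ L`. [folklore] -/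
theorem one_le_cast_pow_sub_one (hL : 2 ≤ P.L) (n : ℕ) : (1 : ℝ) ≤ (((P.L ^ (n + 1) - 1 : ℕ) : ℝ)) := by
  have h2 : 2 ≤ P.L ^ (n + 1) := le_trans hL (Nat.le_self_pow (by omega) _)
  have h1 : 1 ≤ P.L ^ (n + 1) - 1 := by omega
  exact_mod_cast h1

/-- `((d·⌊(L−1)∕2⌋ : ℕ) : ℝ) ≤ d·L`. [folklore] -/
theorem cast_mul_half_le : ((P.d * ((P.L - 1) / 2) : ℕ) : ℝ) ≤ (P.d : ℝ) * P.L := by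
  have h : P.d * ((P.L - 1) / 2) ≤ P.d * P.L := Nat.mul_le_mul_left _ ((Nat.div_le_self _ _).trans (Nat.sub_le _ _))
  exact_mod_cast h

/-- `((L − 1 : ℕ) : ℝ) ≤ L`. [folklore] -/
theorem cast_sub_one_le : ((P.L - 1 : ℕ) : ℝ) ≤ (P.L : ℝ) := by exact_mod_cast Nat.sub_le _ _

/-- ✓p755647's `haa` letter `E₂(n) := (d+2)L·Lⁿ·((d−1)·(L^{n+1}−1)·a₀)` is at most `(d+2)(d−1)·L^{2k}·a₀` for `n + 1 ≤ k`. [folklore] -/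
theorem e2_le (hL : 2 ≤ P.L) {k n : ℕ} (hn : n + 1 ≤ k) {a₀ : ℝ} (ha₀ : 0 ≤ a₀) :
    (((P.d + 2) * P.L : ℕ) : ℝ) * (P.L : ℝ) ^ n * ((((P.d - 1 : ℕ) : ℝ)) * (((P.L ^ (n + 1) - 1 : ℕ) : ℝ)) * a₀) ≤ ((P.d : ℝ) + 2) * ((P.d - 1 : ℕ) : ℝ) * (P.L : ℝ) ^ (2 * k) * a₀ := by
  have hL1 : (1 : ℝ) ≤ P.L := by exact_mod_cast (le_trans (by norm_num) hL)
  have hD1 : (0 : ℝ) ≤ ((P.d - 1 : ℕ) : ℝ) := Nat.cast_nonneg _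
  have hH := cast_pow_sub_one_le (P := P) (n + 1)
  have hH0 : (0 : ℝ) ≤ (((P.L ^ (n + 1) - 1 : ℕ) : ℝ)) := Nat.cast_nonneg _
  have hpow : (P.L : ℝ) * (P.L : ℝ) ^ n * (P.L : ℝ) ^ (n + 1) ≤ (P.L : ℝ) ^ (2 * k) := by
    rw [← pow_succ', ← pow_add]
    exact pow_le_pow_right₀ hL1 (by omega)
  calc (((P.d + 2) * P.L : ℕ) : ℝ) * (P.L : ℝ) ^ n * ((((P.d - 1 : ℕ) : ℝ)) * (((P.L ^ (n + 1) - 1 : ℕ) : ℝ)) * a₀)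
      = ((P.d : ℝ) + 2) * ((P.d - 1 : ℕ) : ℝ) * a₀ * ((P.L : ℝ) * (P.L : ℝ) ^ n * (((P.L ^ (n + 1) - 1 : ℕ) : ℝ))) := by push_cast; ring
    _ ≤ ((P.d : ℝ) + 2) * ((P.d - 1 : ℕ) : ℝ) * a₀ * ((P.L : ℝ) * (P.L : ℝ) ^ n * (P.L : ℝ) ^ (n + 1)) := by
        apply mul_le_mul_of_nonneg_left _ (by positivity)
        exact mul_le_mul_of_nonneg_left hH (by positivity)
    _ ≤ ((P.d : ℝ) + 2) * ((P.d - 1 : ℕ) : ℝ) * a₀ * (P.L : ℝ) ^ (2 * k) := mul_le_mul_of_nonneg_left hpow (by positivity)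
    _ = ((P.d : ℝ) + 2) * ((P.d - 1 : ℕ) : ℝ) * (P.L : ℝ) ^ (2 * k) * a₀ := by ring

/-- ✓p755647's `σ′`-letter `S(a) := 2·(d⌊(L−1)∕2⌋)·((d−1)(L−1)·a)` at `a := 240·E₂(n)` is at most `480·Ω₀`, `Ω₀ := d(d+2)(d−1)²·L^{2k+2}·a₀` (`n + 1 ≤ k`). [folklore] -/
theorem sigma_le (hL : 2 ≤ P.L) {k n : ℕ} (hn : n + 1 ≤ k) {a₀ : ℝ} (ha₀ : 0 ≤ a₀) :
    2 * (((P.d * ((P.L - 1) / 2) : ℕ) : ℝ) * ((((P.d - 1 : ℕ) : ℝ) * ((P.L - 1 : ℕ) : ℝ)) * (240 * ((((P.d + 2) * P.L : ℕ) : ℝ) * (P.L : ℝ) ^ n * ((((P.d - 1 : ℕ) : ℝ)) * (((P.L ^ (n + 1) - 1 : ℕ) : ℝ)) * a₀))))) ≤ 480 * ((P.d : ℝ) * ((P.d : ℝ) + 2) * ((P.d - 1 : ℕ) : ℝ) ^ 2 * (P.L : ℝ) ^ (2 * k + 2) * a₀) := by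
  have hD1 : (0 : ℝ) ≤ ((P.d - 1 : ℕ) : ℝ) := Nat.cast_nonneg _
  have hE := e2_le (P := P) hL hn ha₀
  have hG := cast_mul_half_le (P := P)
  have hL1 := cast_sub_one_le (P := P)
  have hH0 : (0 : ℝ) ≤ (((P.L ^ (n + 1) - 1 : ℕ) : ℝ)) := Nat.cast_nonneg _
  have hE0 : (0 : ℝ) ≤ (((P.d + 2) * P.L : ℕ) : ℝ) * (P.L : ℝ) ^ n * ((((P.d - 1 : ℕ) : ℝ)) * (((P.L ^ (n + 1) - 1 : ℕ) : ℝ)) * a₀) := by positivity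
  have hG0 : (0 : ℝ) ≤ ((P.d * ((P.L - 1) / 2) : ℕ) : ℝ) := Nat.cast_nonneg _
  have hL10 : (0 : ℝ) ≤ ((P.L - 1 : ℕ) : ℝ) := Nat.cast_nonneg _
  calc 2 * (((P.d * ((P.L - 1) / 2) : ℕ) : ℝ) * ((((P.d - 1 : ℕ) : ℝ) * ((P.L - 1 : ℕ) : ℝ)) * (240 * ((((P.d + 2) * P.L : ℕ) : ℝ) * (P.L : ℝ) ^ n * ((((P.d - 1 : ℕ) : ℝ)) * (((P.L ^ (n + 1) - 1 : ℕ) : ℝ)) * a₀)))))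
      ≤ 2 * (((P.d : ℝ) * P.L) * ((((P.d - 1 : ℕ) : ℝ) * (P.L : ℝ)) *
        (240 * (((P.d : ℝ) + 2) * ((P.d - 1 : ℕ) : ℝ) * (P.L : ℝ) ^ (2 * k) * a₀)))) := by
        gcongr
    _ = 480 * ((P.d : ℝ) * ((P.d : ℝ) + 2) * ((P.d - 1 : ℕ) : ℝ) ^ 2 * (P.L : ℝ) ^ (2 * k + 2) * a₀) := by ring

/-- ✓p755647's `hbud`∕`hgd` letter `E₁(n) := ((d+2)L)²·L^{n+1}·((d−1)(L^{n+1}−1)·a₀)` is at most `Ω₁ := (d+2)²(d−1)·L^{2k+2}·a₀` for `n + 1 ≤ k`. [folklore] -/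
theorem e1_le (hL : 2 ≤ P.L) {k n : ℕ} (hn : n + 1 ≤ k) {a₀ : ℝ} (ha₀ : 0 ≤ a₀) :
    (((P.d + 2) * P.L : ℕ) : ℝ) ^ 2 * (P.L : ℝ) ^ (n + 1) * ((((P.d - 1 : ℕ) : ℝ)) * (((P.L ^ (n + 1) - 1 : ℕ) : ℝ)) * a₀) ≤ ((P.d : ℝ) + 2) ^ 2 * ((P.d - 1 : ℕ) : ℝ) * (P.L : ℝ) ^ (2 * k + 2) * a₀ := by
  have hL1 : (1 : ℝ) ≤ P.L := by exact_mod_cast (le_trans (by norm_num) hL)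
  have hD1 : (0 : ℝ) ≤ ((P.d - 1 : ℕ) : ℝ) := Nat.cast_nonneg _
  have hH := cast_pow_sub_one_le (P := P) (n + 1)
  have hH0 : (0 : ℝ) ≤ (((P.L ^ (n + 1) - 1 : ℕ) : ℝ)) := Nat.cast_nonneg _
  have hpow : (P.L : ℝ) ^ 2 * (P.L : ℝ) ^ (n + 1) * (P.L : ℝ) ^ (n + 1) ≤ (P.L : ℝ) ^ (2 * k + 2) := by
    rw [← pow_add, ← pow_add]
    exact pow_le_pow_right₀ hL1 (by omega)
  calc (((P.d + 2) * P.L : ℕ) : ℝ) ^ 2 * (P.L : ℝ) ^ (n + 1) * ((((P.d - 1 : ℕ) : ℝ)) * (((P.L ^ (n + 1) - 1 : ℕ) : ℝ)) * a₀)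
      = ((P.d : ℝ) + 2) ^ 2 * ((P.d - 1 : ℕ) : ℝ) * a₀ * ((P.L : ℝ) ^ 2 * (P.L : ℝ) ^ (n + 1) * (((P.L ^ (n + 1) - 1 : ℕ) : ℝ))) := by push_cast; ring
    _ ≤ ((P.d : ℝ) + 2) ^ 2 * ((P.d - 1 : ℕ) : ℝ) * a₀ * ((P.L : ℝ) ^ 2 * (P.L : ℝ) ^ (n + 1) * (P.L : ℝ) ^ (n + 1)) := by
        apply mul_le_mul_of_nonneg_left _ (by positivity)
        exact mul_le_mul_of_nonneg_left hH (by positivity)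
    _ ≤ ((P.d : ℝ) + 2) ^ 2 * ((P.d - 1 : ℕ) : ℝ) * a₀ * (P.L : ℝ) ^ (2 * k + 2) := mul_le_mul_of_nonneg_left hpow (by positivity)
    _ = ((P.d : ℝ) + 2) ^ 2 * ((P.d - 1 : ℕ) : ℝ) * (P.L : ℝ) ^ (2 * k + 2) * a₀ := by ring

/-- The geometric step: `L^{2m+4}·a ≤ L^{2k+2}·a·(L⁻¹)^{k−(m+1)}` for `m + 1 ≤ k`, `1 ≤ L`, `0 ≤ a`. [folklore] -/
theorem geom_step_le {L : ℝ} (hL : 1 ≤ L) {k m : ℕ} (hm : m + 1 ≤ k) {a : ℝ} (ha : 0 ≤ a) :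
    L ^ (2 * m + 4) * a ≤ L ^ (2 * k + 2) * a * L⁻¹ ^ (k - (m + 1)) := by
  have hL0 : 0 < L := lt_of_lt_of_le one_pos hL
  have hkey : L ^ (2 * m + 4) * L ^ (k - (m + 1)) ≤ L ^ (2 * k + 2) := by
    rw [← pow_add]; exact pow_le_pow_right₀ hL (by omega)
  have hpos : 0 < L ^ (k - (m + 1)) := pow_pos hL0 _
  have hne : L ^ (k - (m + 1)) ≠ 0 := hpos.ne'
  rw [inv_pow]
  calc L ^ (2 * m + 4) * a = L ^ (2 * m + 4) * L ^ (k - (m + 1)) * a * (L ^ (k - (m + 1)))⁻¹ := by field_simp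
    _ ≤ L ^ (2 * k + 2) * a * (L ^ (k - (m + 1)))⁻¹ := by
        apply mul_le_mul_of_nonneg_right _ (inv_nonneg.2 hpos.le)
        exact mul_le_mul_of_nonneg_right hkey ha

/-! ## §2  The schedule -/

/-- ★★★ **THE NUMERIC SCHEDULE OF THE (σ2) SUPPLIER FROM ONE FINE LETTER** — for `2 ≤ d`, `2 ≤ L`, `0 < a₀` and the four smallness conditions `48000·Ω₀ ≤ 1`, `480·Ω₀ < δ_Fed`,
`6400·Ω₁ ≤ 1`, `30·Ω₁ < δ_SU` (`Ω₀ := d(d+2)(d−1)²·L^{2k+2}·a₀`, `Ω₁ := (d+2)²(d−1)·L^{2k+2}·a₀`): the schedule `a(n) := 240·E₂(n)` and `ω := 3840·Ω₀` satisfy ALL numeric binders of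
`…N07SymTauTowerStatementOfFinePlaquettes.tower_statement_geom_of_fineBoxPlaqs` ∕ `…N07SymTauCellRowOfFinePlaquettes` (`hbud`, `hgd`, `haa`, `h100`, `hguard`, and `hE` with `θ := L⁻¹`),
VERBATIM in their shape. [cite: Balaban1987RG1, (0.11) p.253 (bookkeeping); Balaban1985Variational, (147)–(154) pp.301–302; Balaban1985RegularSpaces, (1.15) p.78] -/
theorem schedule_of_fineLetter (N : ℕ) [NeZero N] (hd : 2 ≤ P.d) (hL : 2 ≤ P.L) (k : ℕ) {a₀ : ℝ} (ha₀ : 0 < a₀)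
    (h100 : 48000 * ((P.d : ℝ) * ((P.d : ℝ) + 2) * ((P.d - 1 : ℕ) : ℝ) ^ 2 * (P.L : ℝ) ^ (2 * k + 2) * a₀) ≤ 1)
    (hFed : 480 * ((P.d : ℝ) * ((P.d : ℝ) + 2) * ((P.d - 1 : ℕ) : ℝ) ^ 2 * (P.L : ℝ) ^ (2 * k + 2) * a₀) < (FederbushMean.federbushSU (n := Fin N)).δ)
    (hbud : 6400 * (((P.d : ℝ) + 2) ^ 2 * ((P.d - 1 : ℕ) : ℝ) * (P.L : ℝ) ^ (2 * k + 2) * a₀) ≤ 1)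
    (hgd : 30 * (((P.d : ℝ) + 2) ^ 2 * ((P.d - 1 : ℕ) : ℝ) * (P.L : ℝ) ^ (2 * k + 2) * a₀) < deltaSU (Fin N)) :
    ∃ (a : ℕ → ℝ) (ω : ℝ),
      ω = 3840 * ((P.d : ℝ) * ((P.d : ℝ) + 2) * ((P.d - 1 : ℕ) : ℝ) ^ 2 * (P.L : ℝ) ^ (2 * k + 2) * a₀) ∧ 0 ≤ ω ∧ (∀ n, 0 ≤ a n) ∧
      (∀ n, n < k → 6400 * (((P.d + 2) * P.L : ℕ) : ℝ) ^ 2 * (P.L : ℝ) ^ (n + 1) * ((((P.d - 1 : ℕ) : ℝ)) * (((P.L ^ (n + 1) - 1 : ℕ) : ℝ)) * a₀) ≤ 1) ∧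
      (∀ n, n < k → 30 * (((P.d + 2) * P.L : ℕ) : ℝ) ^ 2 * (P.L : ℝ) ^ (n + 1) * ((((P.d - 1 : ℕ) : ℝ)) * (((P.L ^ (n + 1) - 1 : ℕ) : ℝ)) * a₀) < deltaSU (Fin N)) ∧
      (∀ n, n < k → 120 * (((P.d + 2) * P.L : ℕ) : ℝ) * (P.L : ℝ) ^ n * ((((P.d - 1 : ℕ) : ℝ)) * (((P.L ^ (n + 1) - 1 : ℕ) : ℝ)) * a₀) < a n) ∧
      (∀ n, n < k → 2 * (((P.d * ((P.L - 1) / 2) : ℕ) : ℝ) * ((((P.d - 1 : ℕ) : ℝ) * ((P.L - 1 : ℕ) : ℝ)) * (fun n => 240 * ((((P.d + 2) * P.L : ℕ) : ℝ) * (P.L : ℝ) ^ n * ((((P.d - 1 : ℕ) : ℝ)) * (((P.L ^ (n + 1) - 1 : ℕ) : ℝ)) * a₀))) n)) ≤ 1 / 100) ∧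
      (∀ n, n < k → 2 * (((P.d * ((P.L - 1) / 2) : ℕ) : ℝ) * ((((P.d - 1 : ℕ) : ℝ) * ((P.L - 1 : ℕ) : ℝ)) * (fun n => 240 * ((((P.d + 2) * P.L : ℕ) : ℝ) * (P.L : ℝ) ^ n * ((((P.d - 1 : ℕ) : ℝ)) * (((P.L ^ (n + 1) - 1 : ℕ) : ℝ)) * a₀))) n)) < (FederbushMean.federbushSU (n := Fin N)).δ) ∧
      (∀ m, m < k → 4 * (2 * (((P.d * ((P.L - 1) / 2) : ℕ) : ℝ) * ((((P.d - 1 : ℕ) : ℝ) * ((P.L - 1 : ℕ) : ℝ)) * (fun n => 240 * ((((P.d + 2) * P.L : ℕ) : ℝ) * (P.L : ℝ) ^ n * ((((P.d - 1 : ℕ) : ℝ)) * (((P.L ^ (n + 1) - 1 : ℕ) : ℝ)) * a₀))) m))) ≤ ω / 2 * ((P.L : ℝ)⁻¹) ^ (k - (m + 1))) := by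
  set Ω₀ : ℝ := (P.d : ℝ) * ((P.d : ℝ) + 2) * ((P.d - 1 : ℕ) : ℝ) ^ 2 * (P.L : ℝ) ^ (2 * k + 2) * a₀ with hΩ₀
  have hL1 : (1 : ℝ) ≤ P.L := by exact_mod_cast (le_trans (by norm_num) hL)
  have hD1 : (1 : ℝ) ≤ ((P.d - 1 : ℕ) : ℝ) := by exact_mod_cast (show 1 ≤ P.d - 1 by omega)
  have hΩ₀0 : 0 ≤ Ω₀ := by positivity
  have hE2pos : ∀ n : ℕ, 0 < (((P.d + 2) * P.L : ℕ) : ℝ) * (P.L : ℝ) ^ n * ((((P.d - 1 : ℕ) : ℝ)) * (((P.L ^ (n + 1) - 1 : ℕ) : ℝ)) * a₀) := by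
    intro n
    have h1 : (0 : ℝ) < (((P.d + 2) * P.L : ℕ) : ℝ) := by
      have : 0 < (P.d + 2) * P.L := Nat.mul_pos (by omega) (by omega)
      exact_mod_cast this
    have h2 : (0 : ℝ) < (((P.L ^ (n + 1) - 1 : ℕ) : ℝ)) := lt_of_lt_of_le one_pos (one_le_cast_pow_sub_one hL n)
    have h3 : (0 : ℝ) < ((P.d - 1 : ℕ) : ℝ) := lt_of_lt_of_le one_pos hD1
    positivity
  -- `σ′`-letter of the schedule: `≤ 480·Ω₀` at every `n < k`
  have hS : ∀ n, n < k → 2 * (((P.d * ((P.L - 1) / 2) : ℕ) : ℝ) * ((((P.d - 1 : ℕ) : ℝ) * ((P.L - 1 : ℕ) : ℝ)) * (240 * ((((P.d + 2) * P.L : ℕ) : ℝ) * (P.L : ℝ) ^ n * ((((P.d - 1 : ℕ) : ℝ)) * (((P.L ^ (n + 1) - 1 : ℕ) : ℝ)) * a₀))))) ≤ 480 * Ω₀ :=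
    fun n hn => sigma_le hL (by omega) ha₀.le
  refine ⟨fun n => 240 * ((((P.d + 2) * P.L : ℕ) : ℝ) * (P.L : ℝ) ^ n * ((((P.d - 1 : ℕ) : ℝ)) * (((P.L ^ (n + 1) - 1 : ℕ) : ℝ)) * a₀)), 3840 * Ω₀, rfl, by positivity, fun n => (le_of_lt (by have := hE2pos n; positivity)), fun n hn => ?_, fun n hn => ?_,
    fun n hn => ?_, fun n hn => ?_, fun n hn => ?_, fun m hm => ?_⟩
  · have h := e1_le (P := P) hL (show n + 1 ≤ k by omega) ha₀.le
    linarith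
  · have h := e1_le (P := P) hL (show n + 1 ≤ k by omega) ha₀.le
    linarith
  · have h := hE2pos n
    linarith
  · have h := hS n hn
    linarith
  · exact lt_of_le_of_lt (hS n hn) hFed
  · -- the geometric schedule: `4·S(a m) ≤ 1920·d(d+2)(d−1)²·L^{2m+4}·a₀ ≤ (3840·Ω₀∕2)·(L⁻¹)^{k−(m+1)}`
    have hG := cast_mul_half_le (P := P)
    have hL1' := cast_sub_one_le (P := P)
    have hH := cast_pow_sub_one_le (P := P) (m + 1)
    have hG0 : (0 : ℝ) ≤ ((P.d * ((P.L - 1) / 2) : ℕ) : ℝ) := Nat.cast_nonneg _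
    have hL10 : (0 : ℝ) ≤ ((P.L - 1 : ℕ) : ℝ) := Nat.cast_nonneg _
    have hD10 : (0 : ℝ) ≤ ((P.d - 1 : ℕ) : ℝ) := Nat.cast_nonneg _
    have hH0 : (0 : ℝ) ≤ (((P.L ^ (m + 1) - 1 : ℕ) : ℝ)) := Nat.cast_nonneg _
    have hstep := geom_step_le hL1 (by omega : m + 1 ≤ k) (a := (P.d : ℝ) * ((P.d : ℝ) + 2) * ((P.d - 1 : ℕ) : ℝ) ^ 2 * a₀) (by positivity)
    have hc : (((P.d + 2) * P.L : ℕ) : ℝ) = ((P.d : ℝ) + 2) * P.L := by push_cast; ring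
    calc 4 * (2 * (((P.d * ((P.L - 1) / 2) : ℕ) : ℝ) * ((((P.d - 1 : ℕ) : ℝ) * ((P.L - 1 : ℕ) : ℝ)) * (240 * ((((P.d + 2) * P.L : ℕ) : ℝ) * (P.L : ℝ) ^ m * ((((P.d - 1 : ℕ) : ℝ)) * (((P.L ^ (m + 1) - 1 : ℕ) : ℝ)) * a₀))))))
        = 1920 * ((((P.d * ((P.L - 1) / 2) : ℕ) : ℝ)) * (((P.L - 1 : ℕ) : ℝ)) * ((((P.d - 1 : ℕ) : ℝ)) ^ 2 *
            ((((P.d + 2) * P.L : ℕ) : ℝ) * (P.L : ℝ) ^ m * ((((P.L ^ (m + 1) - 1 : ℕ) : ℝ)) * a₀)))) := by ring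
      _ ≤ 1920 * (((P.d : ℝ) * P.L) * (P.L : ℝ) * ((((P.d - 1 : ℕ) : ℝ)) ^ 2 *
            ((((P.d : ℝ) + 2) * P.L) * (P.L : ℝ) ^ m * ((P.L : ℝ) ^ (m + 1) * a₀)))) := by
          rw [hc]
          gcongr
      _ = 1920 * ((P.L : ℝ) ^ (2 * m + 4) * ((P.d : ℝ) * ((P.d : ℝ) + 2) * ((P.d - 1 : ℕ) : ℝ) ^ 2 * a₀)) := by ring
      _ ≤ 1920 * ((P.L : ℝ) ^ (2 * k + 2) * ((P.d : ℝ) * ((P.d : ℝ) + 2) * ((P.d - 1 : ℕ) : ℝ) ^ 2 * a₀) * (P.L : ℝ)⁻¹ ^ (k - (m + 1))) :=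
          mul_le_mul_of_nonneg_left hstep (by norm_num)
      _ = 3840 * Ω₀ / 2 * ((P.L : ℝ)⁻¹) ^ (k - (m + 1)) := by simp only [hΩ₀]; ring

end Summit.QuantumFields.YangMills.BalabanUVNodes.N07SymTauScheduleNumerics

end
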